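/-
Copyright: lit-balaban Phase-2 proof seat p31 (gen 2).  Statement-level skeleton of a published paper; no proof claims beyond what the
kernel checks below.
-/
import Literature.MathematicalPhysics.QuantumFieldTheory.BalabanImbrieJaffe1984to88.BIJ85Eq219Proof
import Literature.MathematicalPhysics.QuantumFieldTheory.BalabanImbrieJaffe1984to88.BIJ85CellAverages

/-!
# `BalabanImbrieJaffe1984to88.BIJ85CurlQsstar` — T. Bałaban, J. Imbrie, A. Jaffe, *Renormalization of the Higgs model: minimizers,
propagators and the stability of mean field theory*, Commun. Math. Phys. **97** (1985) 299–329 [BalabanImbrieJaffe1985]: the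
edge-plaquette geometry (2.21)–(2.23) ON THE TORI and the commutation identity `∂Q^{s*} = Q^{e*}∂` (p. 317, p. 323) PROVED

statement-level skeleton of published theorems with citation tags; proofs where landed; nothing here is a claim about the Yang–Mills mass gap

PDF held: `paper:balaban1985-cmp97-bij-higgs-minimizers` (journal page = PDF page + 298).  Pages read as images:
`run/shared/lean/pub/lit-balaban/lit-balaban-r15/pages/1985-cmp97-bij-higgs-minimizers-p006-x2.png` (p. 304, Fig. 1), `…-p007-x2.png`
(p. 305), `…-p019-x2.png` (p. 317); `run/shared/lean/pub/pub-balaban/t4/b2b-balaban-t4-lit2/renders/bij1985/…-p025-x2.png` (p. 323).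

CITATION HEADER (lean-in-tree rule).  Part of the lit-balaban TYPED SKELETON (HOME `run/shared/lean/pub/lit-balaban/`), Phase-2 seat
p31 (gen 2), rows **C1.Eq2.20-2.23** (the edge-plaquette instance), **C1.Eq2.24** (case k = 1) of `HOME/SKELETON.md` and the unnumbered
identity used at (5.3.1) p. 317 and (7.1.18) p. 323 (reader file `HOME/lit-balaban-r15/ROWS-C1.md`; fold owner's suggestion S1,
`HOME/INBOX.md` 2026-08-21T02:08:57Z).  WHAT IS REPRODUCED, and how.  p. 305 [PDF 7], verbatim: *"Let p′ denote an L-lattice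
plaquette. The set of edge plaquettes B^e(p′) are defined as those unit plaquettes p which (i) are parallel to p′, (ii) whose bonds
touch four distinct L-blocks, and (iii) such that these L-blocks contain the corners of p′ (see Fig. 1). The edge average Q^e is
defined by (Q^ef)(p′) = L^{−(d−2)} Σ_{p∈B(p′)} f(p). (2.21) Then (Q^{e*}f)(p) = L²f(p′), if p ∈ B^e(p′), 0, otherwise. (2.22) Also
Q^eQ^{e*} = L²I, Q^{e*}Q^e = L²P^e, (2.23)"*; p. 317 [PDF 19]: *"Use the facts Q_kQ^{s*}_k = I and ∂Q^{s*}_kB = Q^{e*}_k∂B"*; p. 323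
[PDF 25]: *"Furthermore Q^{e*}_k∂ = ∂Q^{s*}_k, so τ₁∂ = Q^e_k(I − P_∂)∂Q^{s*}_k = 0. (7.1.18)"*.  The operators already live in the
tree on the uniform cell carrier `BIJ85CellAverages.Cells` ((2.21)–(2.23) for ANY cell geometry of exponent m = 2, the geometry being
"the instance's") and on `BIJ85Sect2SurfaceAverages.BlockBonds` ((2.17) `Qsstar`), instantiated by the tori of `Setup` in
`BIJ85Eq219Proof.torusBlockBonds`; `∂` is `…Balaban1983to89.LatticeFieldCalculus.curl c` (lattice factor `c` = spacing⁻¹).  Here: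
* §1 `torusEdgeCells P j hd` IS the edge-plaquette geometry of the tori `T^{(j)} ⊃ T^{(j+1)}` (fine cells `Plaq P j`, coarse cells
  `Plaq P (j+1)`, `p ∈ B^e(p′)` iff the blocks of the corners `x, x+e_μ, x+e_ν` of `p = ⟨x, μ, ν⟩` are the corners `y, y+e_μ, y+e_ν`
  of `p′ = ⟨y, μ, ν⟩` — (i)–(iii) verbatim, the fourth corner then being automatic, `blockOf_corner`), with `B^e(⟨y, μ, ν⟩) =
  {⟨blockSite y r, μ, ν⟩ : r_μ = r_ν = L − 1}` (`edgeB_eq_map`), the printed count `|B^e(p′)| = L^{d−2}` (`card_edgeB`) and hence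
  **(2.23)** `Q^eQ^{e*} = L²I` OUTRIGHT on the tori (`edgeQ_Qstar_torus`; = (2.24) at k = 1);
* §2 the values of `Q^{s*}B` on the four bonds of a fine plaquette (`Qsstar_blockSite`, `Qsstar_shift_blockSite_*`) and the
  IDENTITY: for every real coarse lattice factor `c` (fine factor `L·c`: the fine spacing is the coarse one over `L`),
  `∂_{Lc}(Q^{s*}B)(p) = L²·(∂_cB)(p′)` for `p ∈ B^e(p′)` and `0` on all other plaquettes — interior plaquettes see no surface bond,
  face plaquettes see two parallel surface bonds of the same coarse bond with opposite orientation (`curl_Qsstar_blockSite`,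
  carrier-free form `curl_Qsstar_apply`, any `d`), i.e. **`∂Q^{s*} = Q^{e*}∂`** as maps (`curl_Qsstar`, `2 ≤ d`), in BIJ's units
  (unit fine lattice, L-lattice factor `L⁻¹`) `curl 1 (Q^{s*}B) = Q^{e*}(curl L⁻¹ B)` (`curl_one_Qsstar`).
Standing range `j + 1 ≤ m + K` of `Setup` (hypothesis `hj`); `2 ≤ d` (hypothesis `hd`) only where the carrier `Cells` (exponent
`m = 2 ≤ d`) is instantiated.  NOT here: the k-fold operators `Q^{s*}_k`, `Q^{e*}_k` as single block-size-`L^k` geometries and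
`Q^{e*}_kQ^{e*} = Q^{e*}_{k+1}` (p. 319) — the one-step identity is what iterates.  Unit `lit-balaban-p31`
(literature-prover-lit-balaban-p31-g2-0), 2026-08-21.
-/

open scoped BigOperators

namespace Literature.MathematicalPhysics.QuantumFieldTheory.BalabanImbrieJaffe1984to88.BIJ85CurlQsstar

open Literature.MathematicalPhysics.QuantumFieldTheory.Balaban1983to89
open BIJ85Sect2SurfaceAverages BIJ85CellAverages LatticeFieldCalculus BIJ85Eq219Proof

variable {P : Params} {j : ℕ}

/-! ## 0. Torus bookkeeping -/

/-- `y + e_μ ≠ y` on every torus of the series (`1 ≠ 0` in `ZMod (2L^{m+K−k})`). [folklore] -/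
private theorem shift_ne_self {k : ℕ} (y : Site P k) (μ : Fin P.d) : y.shift μ ≠ y := by
  intro h
  have h1 := congrFun h μ
  simp only [Site.shift, Function.update_self] at h1
  exact one_ne_zero (add_eq_left.1 h1)

/-- Every fine site is a `blockSite` of its block (standing range; `Site.blockEquiv`). [folklore] -/
private theorem exists_eq_blockSite (hj : j + 1 ≤ P.m + P.K) (x : Site P j) :
    ∃ r : Fin P.d → Fin P.L, x = Site.blockSite (blockOf x) r := by
  refine ⟨Site.blockEquiv hj (blockOf x) ⟨x, rfl⟩, ?_⟩
  have h := (Site.blockEquiv hj (blockOf x)).symm_apply_apply ⟨x, rfl⟩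
  exact (congrArg Subtype.val h).symm

/-- `x + e_μ` is `runSite x μ 1`. [folklore] -/
private theorem runSite_one {k : ℕ} (x : Site P k) (μ : Fin P.d) : runSite x μ 1 = x.shift μ := by
  simp [runSite, Site.shift]

/-- The neighbour `x + e_μ` of `x = blockSite y r ∈ B(y)`: the site of `B(y)` with offset `r_μ + 1` while `r_μ + 1 < L` …
[cite: BalabanImbrieJaffe1985, (2.15) p.304] -/
theorem shift_blockSite_of_lt (y : Site P (j + 1)) (r : Fin P.d → Fin P.L) (μ : Fin P.d) (h : (r μ : ℕ) + 1 < P.L) :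
    (Site.blockSite y r).shift μ = Site.blockSite y (Function.update r μ ⟨r μ + 1, h⟩) := by
  rw [← runSite_one]
  exact runSite_blockSite_of_lt y r μ h

/-- … and the site of the NEXT block `B(y + e_μ)` with offset `0` when `r_μ + 1 = L` (standing range).
[cite: BalabanImbrieJaffe1985, (2.15) p.304] -/
theorem shift_blockSite_of_eq (hj : j + 1 ≤ P.m + P.K) (y : Site P (j + 1)) (r : Fin P.d → Fin P.L) (μ : Fin P.d)
    (h : (r μ : ℕ) + 1 = P.L) :
    (Site.blockSite y r).shift μ = Site.blockSite (y.shift μ) (Function.update r μ ⟨0, P.L_pos⟩) := by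
  rw [← runSite_one, runSite_blockSite_of_ge hj y r μ (t := 1) (by omega) (by omega)]
  congr 2
  exact Fin.ext (by simp only; omega)

/-- The block of the neighbour `x + e_μ` of `x = blockSite y r`: `y + e_μ` if `r_μ + 1 = L` (the bond `⟨x, x + e_μ⟩` is a surface bond),
`y` otherwise (an interior bond) (standing range). [cite: BalabanImbrieJaffe1985, (2.15) p.304] -/
theorem blockOf_shift_blockSite (hj : j + 1 ≤ P.m + P.K) (y : Site P (j + 1)) (r : Fin P.d → Fin P.L) (μ : Fin P.d) :
    blockOf ((Site.blockSite y r).shift μ) = if (r μ : ℕ) + 1 = P.L then y.shift μ else y := by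
  split_ifs with h
  · rw [shift_blockSite_of_eq hj y r μ h, Site.blockOf_blockSite hj]
  · rw [shift_blockSite_of_lt y r μ (by have := (r μ).isLt; omega), Site.blockOf_blockSite hj]

/-! ## 1. The edge-plaquette geometry (2.21)–(2.23) of the tori -/

/-- BIJ's EDGE-PLAQUETTE geometry of Sect. 2 p. 305 [PDF 7] INSTANTIATED BY THE TORI of the series, as the uniform cell carrier
`BIJ85CellAverages.Cells` with exponent `m = 2`: fine cells = plaquettes of `T^{(j)}` (`Plaq P j`), coarse cells = plaquettes of
`T^{(j+1)}`, and `p = ⟨x, μ, ν⟩` lies in `B^e(p′)`, `p′ = ⟨blockOf x, μ, ν⟩`, iff both bonds `⟨x, x + e_μ⟩`, `⟨x, x + e_ν⟩` leave the block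
`B(blockOf x)` — verbatim *"those unit plaquettes p which (i) are parallel to p′, (ii) whose bonds touch four distinct L-blocks, and
(iii) such that these L-blocks contain the corners of p′"* (`mem_edgeB_iff`, `blockOf_corner`); block size `P.L`, dimension `P.d ≥ 2`
(hypothesis `hd`: the carrier requires `m ≤ d`). [cite: BalabanImbrieJaffe1985, (2.21) p.305] -/
@[reducible] noncomputable def torusEdgeCells (P : Params) (j : ℕ) (hd : 2 ≤ P.d) : Cells where
  F := Plaq P j
  C := Plaq P (j + 1)
  fF := inferInstance
  fC := inferInstance
  dF := Classical.decEq _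
  dC := Classical.decEq _
  cell p := if blockOf (p.src.shift p.μ) = (blockOf p.src).shift p.μ ∧ blockOf (p.src.shift p.ν) = (blockOf p.src).shift p.ν
    then some ⟨blockOf p.src, p.μ, p.ν, p.hμν⟩ else none
  L := P.L
  d := P.d
  m := 2
  one_le_L := by have := P.hL.2; omega
  m_le_d := hd

/-- kernel: membership in `B^e(p′)` on the tori, in the vocabulary of `Setup` — (i) `p` parallel to `p′`, (ii)–(iii) the blocks of the
corners `x`, `x + e_μ`, `x + e_ν` of `p` are the corners `y`, `y + e_μ`, `y + e_ν` of `p′` (the fourth corner follows, `blockOf_corner`).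
[cite: BalabanImbrieJaffe1985, (2.21) p.305] -/
theorem mem_edgeB_iff (hd : 2 ≤ P.d) (p' : Plaq P (j + 1)) (p : Plaq P j) :
    p ∈ (torusEdgeCells P j hd).B p' ↔
      p.μ = p'.μ ∧ p.ν = p'.ν ∧ blockOf p.src = p'.src ∧ blockOf (p.src.shift p.μ) = p'.src.shift p'.μ ∧
        blockOf (p.src.shift p.ν) = p'.src.shift p'.ν := by
  rw [(torusEdgeCells P j hd).mem_B]
  show (if blockOf (p.src.shift p.μ) = (blockOf p.src).shift p.μ ∧ blockOf (p.src.shift p.ν) = (blockOf p.src).shift p.ν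
    then some (⟨blockOf p.src, p.μ, p.ν, p.hμν⟩ : Plaq P (j + 1)) else none) = some p' ↔ _
  obtain ⟨x, μ, ν, hμν⟩ := p
  obtain ⟨y, μ', ν', hμν'⟩ := p'
  simp only
  constructor
  · intro h
    split_ifs at h with hc
    simp only [Option.some.injEq, Plaq.mk.injEq] at h
    obtain ⟨rfl, rfl, rfl⟩ := h
    exact ⟨rfl, rfl, rfl, hc.1, hc.2⟩
  · rintro ⟨rfl, rfl, rfl, h1, h2⟩
    rw [if_pos ⟨h1, h2⟩]

/-- kernel geometry of (2.21) on the tori: for `x = blockSite y r`, the plaquette `⟨x, μ, ν⟩` is an edge plaquette iff `r_μ = r_ν = L − 1`,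
and then it lies in `B^e(⟨y, μ, ν⟩)` (standing range). [cite: BalabanImbrieJaffe1985, (2.21) p.305] -/
theorem mem_edgeB_blockSite_iff (hj : j + 1 ≤ P.m + P.K) (hd : 2 ≤ P.d) (p' : Plaq P (j + 1)) (y : Site P (j + 1))
    (r : Fin P.d → Fin P.L) {μ ν : Fin P.d} (hμν : μ < ν) :
    (⟨Site.blockSite y r, μ, ν, hμν⟩ : Plaq P j) ∈ (torusEdgeCells P j hd).B p' ↔
      p' = ⟨y, μ, ν, hμν⟩ ∧ (r μ : ℕ) + 1 = P.L ∧ (r ν : ℕ) + 1 = P.L := by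
  rw [mem_edgeB_iff, Site.blockOf_blockSite hj, blockOf_shift_blockSite hj, blockOf_shift_blockSite hj]
  obtain ⟨y', μ', ν', hμν'⟩ := p'
  simp only [Plaq.mk.injEq]
  constructor
  · rintro ⟨rfl, rfl, rfl, h1, h2⟩
    refine ⟨⟨rfl, rfl, rfl⟩, ?_, ?_⟩
    · by_contra hne
      rw [if_neg hne] at h1
      exact shift_ne_self y μ h1.symm
    · by_contra hne
      rw [if_neg hne] at h2
      exact shift_ne_self y ν h2.symm
  · rintro ⟨⟨rfl, rfl, rfl⟩, h1, h2⟩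
    exact ⟨rfl, rfl, rfl, by rw [if_pos h1], by rw [if_pos h2]⟩

/-- kernel, (ii)–(iii) completed: for an edge plaquette `p ∈ B^e(p′)` the FOURTH corner `x + e_μ + e_ν` of `p` lies in the block of
the fourth corner `y + e_μ + e_ν` of `p′` as well (*"whose bonds touch four distinct L-blocks … these L-blocks contain the corners of
p′"*; standing range). [cite: BalabanImbrieJaffe1985, (2.21) p.305] -/
theorem blockOf_corner (hj : j + 1 ≤ P.m + P.K) (hd : 2 ≤ P.d) {p' : Plaq P (j + 1)} {p : Plaq P j}
    (h : p ∈ (torusEdgeCells P j hd).B p') : blockOf ((p.src.shift p.μ).shift p.ν) = (p'.src.shift p'.μ).shift p'.ν := by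
  obtain ⟨x, μ, ν, hμν⟩ := p
  obtain ⟨r, hr⟩ := exists_eq_blockSite hj x
  rw [hr] at h
  obtain ⟨rfl, hμ, hν⟩ := (mem_edgeB_blockSite_iff hj hd p' (blockOf x) r hμν).mp h
  simp only
  rw [hr, Site.blockOf_blockSite hj, shift_blockSite_of_eq hj (blockOf x) r μ hμ, blockOf_shift_blockSite hj,
    if_pos (show ((Function.update r μ (⟨0, P.L_pos⟩ : Fin P.L) ν : Fin P.L) : ℕ) + 1 = P.L by
      rw [Function.update_of_ne (ne_of_lt hμν).symm]; exact hν)]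

/-- kernel: `r ↦ ⟨blockSite y r, μ, ν⟩` is injective (standing range) — the edge plaquettes of `p′` as an embedded copy of the free
offsets. [cite: BalabanImbrieJaffe1985, (2.21) p.305] -/
def edgePlaqEmb (hj : j + 1 ≤ P.m + P.K) (y : Site P (j + 1)) {μ ν : Fin P.d} (hμν : μ < ν) : (Fin P.d → Fin P.L) ↪ Plaq P j :=
  ⟨fun r => ⟨Site.blockSite y r, μ, ν, hμν⟩, fun _ _ h => (AveragingRT.blockSite_inj hj (Plaq.mk.inj h).1).2⟩

/-- kernel geometry of (2.21): on the tori the edge plaquettes of `p′ = ⟨y, μ, ν⟩` are exactly the plaquettes `⟨blockSite y r, μ, ν⟩` with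
offsets `r_μ = r_ν = L − 1` (the edge of `B(y)` towards `B(y + e_μ)` and `B(y + e_ν)`; Fig. 1 p. 304), the other `d − 2` offsets free
(standing range). [cite: BalabanImbrieJaffe1985, (2.21) p.305] -/
theorem edgeB_eq_map (hj : j + 1 ≤ P.m + P.K) (hd : 2 ≤ P.d) (y : Site P (j + 1)) {μ ν : Fin P.d} (hμν : μ < ν) :
    (torusEdgeCells P j hd).B ⟨y, μ, ν, hμν⟩ =
      (Fintype.piFinset fun κ => if κ = μ ∨ κ = ν then {(⟨P.L - 1, by have := P.hL.2; omega⟩ : Fin P.L)} else Finset.univ).map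
        (edgePlaqEmb hj y hμν) := by
  ext p
  rw [Finset.mem_map]
  constructor
  · intro h
    obtain ⟨x, μ₀, ν₀, hμν₀⟩ := p
    obtain ⟨r, hr⟩ := exists_eq_blockSite hj x
    have h0 := (mem_edgeB_iff hd _ _).mp h
    obtain ⟨rfl, rfl, hy, -, -⟩ := h0
    simp only at hy
    rw [hr, hy] at h
    obtain ⟨-, hμ, hν⟩ := (mem_edgeB_blockSite_iff hj hd _ y r hμν₀).mp h
    refine ⟨r, Fintype.mem_piFinset.mpr fun κ => ?_, ?_⟩
    · by_cases hκ : κ = μ₀ ∨ κ = ν₀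
      · rw [if_pos hκ, Finset.mem_singleton]
        rcases hκ with rfl | rfl
        · exact Fin.ext (by simp only; omega)
        · exact Fin.ext (by simp only; omega)
      · rw [if_neg hκ]
        exact Finset.mem_univ _
    · show (⟨Site.blockSite y r, μ₀, ν₀, hμν⟩ : Plaq P j) = ⟨x, μ₀, ν₀, hμν₀⟩
      simp only [Plaq.mk.injEq, and_true]
      rw [hr, hy]
  · rintro ⟨r, hr, rfl⟩
    have hL := P.hL.2
    have hμ : (r μ : ℕ) = P.L - 1 := by
      have := Fintype.mem_piFinset.mp hr μ
      rw [if_pos (Or.inl rfl), Finset.mem_singleton] at this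
      exact congrArg Fin.val this
    have hν : (r ν : ℕ) = P.L - 1 := by
      have := Fintype.mem_piFinset.mp hr ν
      rw [if_pos (Or.inr rfl), Finset.mem_singleton] at this
      exact congrArg Fin.val this
    exact (mem_edgeB_blockSite_iff hj hd _ y r hμν).mpr ⟨rfl, by omega, by omega⟩

/-- The printed count behind (2.23): *an L-cube edge carries L^{d−2} edge plaquettes* — `|B^e(p′)| = L^{d−2}` on the tori (standing
range). [cite: BalabanImbrieJaffe1985, (2.23) p.305] -/
theorem card_edgeB (hj : j + 1 ≤ P.m + P.K) (hd : 2 ≤ P.d) (p' : Plaq P (j + 1)) :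
    ((torusEdgeCells P j hd).B p').card = P.L ^ (P.d - 2) := by
  obtain ⟨y, μ, ν, hμν⟩ := p'
  have hne : μ ≠ ν := ne_of_lt hμν
  rw [edgeB_eq_map hj hd y hμν, Finset.card_map, Fintype.card_piFinset]
  rw [Finset.prod_congr rfl fun κ _ => apply_ite Finset.card _ _ _, Finset.prod_ite]
  simp only [Finset.card_singleton, Finset.prod_const_one, one_mul, Finset.card_univ, Fintype.card_fin, Finset.prod_const]
  congr 1
  have hfilter : (Finset.univ.filter fun κ : Fin P.d => ¬(κ = μ ∨ κ = ν)) = Finset.univ \ {μ, ν} := by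
    ext κ
    simp [not_or]
  rw [hfilter, Finset.card_univ_sdiff, Finset.card_pair hne, Fintype.card_fin]

/-- **(2.23)** p. 305 [PDF 7], first identity, *"Q^eQ^{e*} = L²I"* (and (2.24) at k = 1) — now OUTRIGHT on the tori of the series (the
count hypothesis `hcard` of `Cells.Q_Qstar` discharged by `card_edgeB`). [cite: BalabanImbrieJaffe1985, (2.23) p.305] -/
theorem edgeQ_Qstar_torus (hj : j + 1 ≤ P.m + P.K) (hd : 2 ≤ P.d) (g : Plaq P (j + 1) → ℝ) (p' : Plaq P (j + 1)) :
    (torusEdgeCells P j hd).Q ((torusEdgeCells P j hd).Qstar g) p' = (P.L : ℝ) ^ 2 * g p' :=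
  (torusEdgeCells P j hd).Q_Qstar (card_edgeB hj hd) g p'

/-- **(2.23)** p. 305 [PDF 7], second identity, *"Q^{e*}Q^e = L²P^e, where P^e is the orthogonal projection onto configurations which
are constant on edge plaquettes and zero elsewhere"* — on the tori `P^e` IS a projection outright (`Cells.P_idem` with its count
hypothesis discharged by `card_edgeB`; symmetric by `Cells.inner_P_symm`). [cite: BalabanImbrieJaffe1985, (2.23) p.305] -/
theorem edgeP_idem_torus (hj : j + 1 ≤ P.m + P.K) (hd : 2 ≤ P.d) (f : Plaq P j → ℝ) (p : Plaq P j) :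
    (torusEdgeCells P j hd).P ((torusEdgeCells P j hd).P f) p = (torusEdgeCells P j hd).P f p :=
  (torusEdgeCells P j hd).P_idem (card_edgeB hj hd) f p

/-! ## 2. `∂Q^{s*} = Q^{e*}∂` (p. 317, p. 323) -/

/-- kernel: the value of `Q^{s*}B` ((2.17)) on the bond `⟨x, x + e_μ⟩`, `x = blockSite y r`: `L·B(⟨y, y + e_μ⟩)` if `r_μ = L − 1` (a surface
bond of `⟨y, y + e_μ⟩`), `0` otherwise (an interior bond) (standing range). [cite: BalabanImbrieJaffe1985, (2.17) p.304] -/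
theorem Qsstar_blockSite (hj : j + 1 ≤ P.m + P.K) (B : PBond P (j + 1) → ℝ) (y : Site P (j + 1)) (r : Fin P.d → Fin P.L)
    (μ : Fin P.d) :
    (torusBlockBonds P j).Qsstar B ⟨Site.blockSite y r, μ⟩ = if (r μ : ℕ) + 1 = P.L then (P.L : ℝ) * B ⟨y, μ⟩ else 0 := by
  have h := Qsstar_runBond hj B y r μ (t := 0) P.L_pos
  simpa only [runBond, runSite_zero, add_zero] using h

/-- kernel: the value of `Q^{s*}B` on the bond `⟨x + e_μ, x + e_μ + e_ν⟩`, `ν ≠ μ`, when `x + e_μ` stays in `B(y)` (`r_μ + 1 < L`): `L·B(⟨y, y + e_ν⟩)`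
if `r_ν = L − 1`, else `0` (standing range). [cite: BalabanImbrieJaffe1985, (2.17) p.304] -/
theorem Qsstar_shift_blockSite_of_lt (hj : j + 1 ≤ P.m + P.K) (B : PBond P (j + 1) → ℝ) (y : Site P (j + 1))
    (r : Fin P.d → Fin P.L) {μ ν : Fin P.d} (hne : ν ≠ μ) (hμ : (r μ : ℕ) + 1 < P.L) :
    (torusBlockBonds P j).Qsstar B ⟨(Site.blockSite y r).shift μ, ν⟩ = if (r ν : ℕ) + 1 = P.L then (P.L : ℝ) * B ⟨y, ν⟩ else 0 := by
  rw [shift_blockSite_of_lt y r μ hμ, Qsstar_blockSite hj, Function.update_of_ne hne]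

/-- kernel: the value of `Q^{s*}B` on the bond `⟨x + e_μ, x + e_μ + e_ν⟩`, `ν ≠ μ`, when `x + e_μ` has left `B(y)` (`r_μ + 1 = L`):
`L·B(⟨y + e_μ, y + e_μ + e_ν⟩)` if `r_ν = L − 1`, else `0` (standing range). [cite: BalabanImbrieJaffe1985, (2.17) p.304] -/
theorem Qsstar_shift_blockSite_of_eq (hj : j + 1 ≤ P.m + P.K) (B : PBond P (j + 1) → ℝ) (y : Site P (j + 1))
    (r : Fin P.d → Fin P.L) {μ ν : Fin P.d} (hne : ν ≠ μ) (hμ : (r μ : ℕ) + 1 = P.L) :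
    (torusBlockBonds P j).Qsstar B ⟨(Site.blockSite y r).shift μ, ν⟩ =
      if (r ν : ℕ) + 1 = P.L then (P.L : ℝ) * B ⟨y.shift μ, ν⟩ else 0 := by
  rw [shift_blockSite_of_eq hj y r μ hμ, Qsstar_blockSite hj, Function.update_of_ne hne]

/-- THE IDENTITY ON EACH PLAQUETTE (any `d`): for a coarse lattice factor `c` and the fine factor `L·c`, the plaquette variable of `Q^{s*}B` at
`p = ⟨x, μ, ν⟩`, `x = blockSite y r`, is `L²·(∂_cB)(⟨y, μ, ν⟩)` when `r_μ = r_ν = L − 1` (an edge plaquette: its four bonds are surface bonds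
of the four bonds of `⟨y, μ, ν⟩`) and `0` otherwise (no surface bond, or two parallel surface bonds of one coarse bond with opposite
orientation) — *"∂Q^{s*}_kB = Q^{e*}_k∂B"* p. 317 at k = 1, with (2.22) read off (standing range). [cite: BalabanImbrieJaffe1985, (5.3.1) p.317] -/
theorem curl_Qsstar_blockSite (hj : j + 1 ≤ P.m + P.K) (c : ℝ) (B : PBond P (j + 1) → ℝ) (y : Site P (j + 1))
    (r : Fin P.d → Fin P.L) {μ ν : Fin P.d} (hμν : μ < ν) :
    curl ((P.L : ℝ) * c) ((torusBlockBonds P j).Qsstar B) ⟨Site.blockSite y r, μ, ν, hμν⟩ =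
      if (r μ : ℕ) + 1 = P.L ∧ (r ν : ℕ) + 1 = P.L then (P.L : ℝ) ^ 2 * curl c B ⟨y, μ, ν, hμν⟩ else 0 := by
  have hne : μ ≠ ν := ne_of_lt hμν
  have hrμ := (r μ).isLt
  have hrν := (r ν).isLt
  simp only [curl, smul_eq_mul]
  rw [Qsstar_blockSite hj B y r μ, Qsstar_blockSite hj B y r ν]
  by_cases hμ : (r μ : ℕ) + 1 = P.L <;> by_cases hν : (r ν : ℕ) + 1 = P.L
  · rw [Qsstar_shift_blockSite_of_eq hj B y r hne.symm hμ, Qsstar_shift_blockSite_of_eq hj B y r hne hν]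
    simp only [hμ, hν, and_self, reduceIte]
    ring
  · rw [Qsstar_shift_blockSite_of_eq hj B y r hne.symm hμ, Qsstar_shift_blockSite_of_lt hj B y r hne (by omega)]
    simp only [hμ, hν, and_false, reduceIte]
    ring
  · rw [Qsstar_shift_blockSite_of_lt hj B y r hne.symm (by omega), Qsstar_shift_blockSite_of_eq hj B y r hne hν]
    simp only [hμ, hν, false_and, reduceIte]
    ring
  · rw [Qsstar_shift_blockSite_of_lt hj B y r hne.symm (by omega), Qsstar_shift_blockSite_of_lt hj B y r hne (by omega)]
    simp only [hμ, hν, and_self, reduceIte]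
    ring

/-- THE IDENTITY, carrier-free form on an arbitrary fine plaquette (any `d`): `(∂_{Lc}Q^{s*}B)(p) = L²(∂_cB)(p′)` if both bonds `⟨x, x + e_μ⟩`,
`⟨x, x + e_ν⟩` of `p = ⟨x, μ, ν⟩` leave the block of `x` (then `p ∈ B^e(p′)`, `p′ = ⟨blockOf x, μ, ν⟩`), and `0` otherwise — the two printed
cases of (2.22) applied to `∂_cB` (standing range). [cite: BalabanImbrieJaffe1985, (5.3.1) p.317] -/
theorem curl_Qsstar_apply (hj : j + 1 ≤ P.m + P.K) (c : ℝ) (B : PBond P (j + 1) → ℝ) (p : Plaq P j) :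
    curl ((P.L : ℝ) * c) ((torusBlockBonds P j).Qsstar B) p =
      if blockOf (p.src.shift p.μ) = (blockOf p.src).shift p.μ ∧ blockOf (p.src.shift p.ν) = (blockOf p.src).shift p.ν
      then (P.L : ℝ) ^ 2 * curl c B ⟨blockOf p.src, p.μ, p.ν, p.hμν⟩ else 0 := by
  obtain ⟨x, μ, ν, hμν⟩ := p
  obtain ⟨r, hr⟩ := exists_eq_blockSite hj x
  simp only
  rw [hr, curl_Qsstar_blockSite hj c B (blockOf x) r hμν, blockOf_shift_blockSite hj, blockOf_shift_blockSite hj,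
    Site.blockOf_blockSite hj]
  have h1 := shift_ne_self (blockOf x) μ
  have h2 := shift_ne_self (blockOf x) ν
  by_cases hμ : (r μ : ℕ) + 1 = P.L <;> by_cases hν : (r ν : ℕ) + 1 = P.L <;> simp [hμ, hν, h1.symm, h2.symm]

/-- **`∂Q^{s*} = Q^{e*}∂`** — p. 317 [PDF 19], verbatim: *"Use the facts Q_kQ^{s*}_k = I and ∂Q^{s*}_kB = Q^{e*}_k∂B"*; p. 323 [PDF 25]:
*"Furthermore Q^{e*}_k∂ = ∂Q^{s*}_k"* — PROVED at k = 1 on the tori of the series as an identity of maps (coarse bond fields on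
`T^{(j+1)}` → plaquette fields on `T^{(j)}`): for every coarse lattice factor `c` (fine factor `L·c`), `∂_{Lc} ∘ Q^{s*} = Q^{e*} ∘ ∂_c`
with `Q^{s*}` = (2.17) of `torusBlockBonds` and `Q^{e*}` = (2.22) of `torusEdgeCells` (standing range; `2 ≤ d` for the carrier).
[cite: BalabanImbrieJaffe1985, (5.3.1) p.317] -/
theorem curl_Qsstar (hj : j + 1 ≤ P.m + P.K) (hd : 2 ≤ P.d) (c : ℝ) (B : PBond P (j + 1) → ℝ) :
    curl ((P.L : ℝ) * c) ((torusBlockBonds P j).Qsstar B) = (torusEdgeCells P j hd).Qstar (curl c B) := by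
  funext p
  obtain ⟨x, μ, ν, hμν⟩ := p
  obtain ⟨r, hr⟩ := exists_eq_blockSite hj x
  rw [hr, curl_Qsstar_blockSite hj c B (blockOf x) r hμν]
  split_ifs with h
  · rw [(torusEdgeCells P j hd).Qstar_of_mem (curl c B)
      ((mem_edgeB_blockSite_iff hj hd _ (blockOf x) r hμν).mpr ⟨rfl, h.1, h.2⟩)]
  · rw [(torusEdgeCells P j hd).Qstar_of_not_mem (curl c B) fun p' hp' =>
      h ((mem_edgeB_blockSite_iff hj hd p' (blockOf x) r hμν).mp hp').2]

/-- **`Q^{e*}∂ = ∂Q^{s*}`** in the units of Sect. 2–3 (unit fine lattice, `∂` with factor `1`; L-lattice with factor `L⁻¹`):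
`∂(Q^{s*}B) = Q^{e*}(∂_{L⁻¹}B)` on the tori — the form used at (3.13) p. 307, (5.3.1) p. 317 (k = 1) and in (7.1.18) p. 323 (standing range,
`2 ≤ d`). [cite: BalabanImbrieJaffe1985, (7.1.18) p.323] -/
theorem curl_one_Qsstar (hj : j + 1 ≤ P.m + P.K) (hd : 2 ≤ P.d) (B : PBond P (j + 1) → ℝ) :
    curl 1 ((torusBlockBonds P j).Qsstar B) = (torusEdgeCells P j hd).Qstar (curl ((P.L : ℝ)⁻¹) B) := by
  have hL : (P.L : ℝ) ≠ 0 := Nat.cast_ne_zero.mpr P.L_pos.ne'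
  have h := curl_Qsstar hj hd ((P.L : ℝ)⁻¹) B
  rwa [mul_inv_cancel₀ hL] at h

end Literature.MathematicalPhysics.QuantumFieldTheory.BalabanImbrieJaffe1984to88.BIJ85CurlQsstar
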